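import Literature.Analysis.FunctionSpaces.TorusSpaceTime
import Literature.Analysis.FunctionSpaces.TorusFourierCalculus
import Literature.Analysis.FunctionSpaces.TorusAxisAverage
import HarnessLib

/-!
# Planar lifts `T² → T³` and `2½`-dimensional fields

The `2½`-dimensional ansatz of the mixing-based anomalous-dissipation constructions
(Bruè–De Lellis, Comm. Math. Phys. 400 (2023), §3; Cheskidov, arXiv:2311.04182, §3, (3.7):
`u(x,t) = (ṽ(x₁,x₂,t), ρ̃(x₁,x₂,t))`; also the shear flows of DiPerna–Majda / Bardos–Titi in
`ShearFlowViscositySelection`) builds velocity fields on `T³` out of a planar velocity field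
`V : T² → ℝ²` and a scalar `R : T² → ℝ` that do not depend on the third coordinate. This file
provides the glue between the accepted torus calculus on `T² = UnitAddTorus (Fin 2)` and on
`T³ = UnitAddTorus (Fin 3)`:

* the planar projection `Torus.planarProj : T³ → T²`, `x ↦ (x₀, x₁)`, its linear model
  `Torus.planarProjE : ℝ³ →L[ℝ] ℝ²`, and the calculus of planar lifts `g ∘ planarProj`
  (smoothness, directional/partial derivatives, Laplacian, time derivatives);
* the embedding `Torus.planarEmbed : ℝ² × ℝ →L[ℝ] ℝ³`, `(a, r) ↦ (a₀, a₁, r)`, the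
  `2½`-dimensional field `Torus.twoHalf V R : T³ → ℝ³`, `x ↦ (V(x₀,x₁), R(x₀,x₁))`, and its
  calculus: `div (V,R) = (div V) ∘ π` (`Torus.divergence_twoHalf`),
  `((V,R)·∇)(V,R) = ((V·∇)V, V·∇R) ∘ π` (`Torus.convect_twoHalf`), `Δ(V,R) = (ΔV, ΔR) ∘ π`
  (`Torus.laplacian_twoHalf`), `∂ₜ(V,R) = (∂ₜV, ∂ₜR)` (`Torus.timeDerivWithin_twoHalf`), joint
  smoothness, norms and inner products;
* measure theory: `planarProj` preserves volume (`Torus.measurePreserving_planarProj`: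
  `T³ ≃ T¹ × T²` via `MeasurableEquiv.piFinSuccAbove`, then `measurePreserving_snd`), hence
  `∫_{T³} b ∘ π = ∫_{T²} b`, and the Fourier coefficients of planar lifts
  (`Torus.mFourierCoeff_comp_planarProj`: `𝓕(b ∘ π)(K) = 𝓕b(K₀,K₁)` if `K₂ = 0`, else `0`).

## References

* E. Bruè, C. De Lellis, *Anomalous dissipation for the forced 3D Navier–Stokes equations*,
  Comm. Math. Phys. 400 (2023), §3 (the `2½`-dimensional Navier–Stokes solutions).
* A. Cheskidov, *Dissipation anomaly and anomalous dissipation in incompressible fluid flows*,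
  arXiv:2311.04182 (2023), §3, (3.7).
* A. J. Majda, A. L. Bertozzi, *Vorticity and Incompressible Flow* (CUP 2002), §2.3.1
  (two-and-a-half-dimensional flows).
-/

open Set Topology Filter MeasureTheory UnitAddTorus
open scoped NNReal ENNReal InnerProductSpace

noncomputable section

namespace Literature.Analysis.FunctionSpaces.Torus

/-- The flat three-torus (local notation). [folklore] -/
local notation "𝕋³" => UnitAddTorus (Fin 3)
/-- The flat two-torus (local notation). [folklore] -/
local notation "𝕋²" => UnitAddTorus (Fin 2)
/-- `ℝ³` (local notation). [folklore] -/
local notation "E³" => EuclideanSpace ℝ (Fin 3)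
/-- `ℝ²` (local notation). [folklore] -/
local notation "E²" => EuclideanSpace ℝ (Fin 2)

/-! ## Small `Fin 3` helpers -/

/-- In `Fin 3`, the planar indices are not the vertical one. [folklore] -/
theorem castSucc_ne_two (j : Fin 2) : (Fin.castSucc j : Fin 3) ≠ 2 := (Fin.castSucc_lt_last j).ne

/-- `Fin.last 2 = 2` (the simp-normal form of the vertical index). [folklore] -/
theorem last_two_eq : (Fin.last 2 : Fin 3) = 2 := rfl

/-- `Fin.lastCases` at the numeral `2 : Fin 3`. [folklore] -/
theorem lastCases_two {C : Sort*} (a : C) (b : Fin 2 → C) :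
    Fin.lastCases (motive := fun _ => C) a b (2 : Fin 3) = a :=
  Fin.lastCases_last

/-! ## The planar projection `T³ → T²` and its linear model `ℝ³ → ℝ²` -/

/-- The projection `T³ → T²` onto the first two coordinates, `x ↦ (x₀, x₁)`. [folklore] -/
def planarProj (x : 𝕋³) : 𝕋² := fun i => x (Fin.castSucc i)

/-- The linear projection `ℝ³ → ℝ²` onto the first two coordinates. [folklore] -/
def planarProjE : E³ →L[ℝ] E² :=
  ((EuclideanSpace.equiv (Fin 2) ℝ).symm : (Fin 2 → ℝ) →L[ℝ] E²).comp
    (ContinuousLinearMap.pi fun i : Fin 2 => (EuclideanSpace.proj (Fin.castSucc i) : E³ →L[ℝ] ℝ))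

/-- Coordinates of the planar projection. [folklore] -/
@[simp]
theorem planarProj_apply (x : 𝕋³) (i : Fin 2) : planarProj x i = x (Fin.castSucc i) := rfl

/-- Coordinates of the linear planar projection. [folklore] -/
@[simp]
theorem planarProjE_apply (y : E³) (i : Fin 2) : planarProjE y i = y (Fin.castSucc i) := by
  simp [planarProjE]

/-- The planar projection is additive. [folklore] -/
theorem planarProj_add (x y : 𝕋³) : planarProj (x + y) = planarProj x + planarProj y := rfl

/-- The two projections are intertwined by the covering maps. [folklore] -/
theorem planarProj_proj (y : E³) : planarProj (proj y) = proj (planarProjE y) := by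
  funext i
  simp

/-- `planarProjE` is norm-non-increasing. [folklore] -/
theorem norm_planarProjE_le (y : E³) : ‖planarProjE y‖ ≤ ‖y‖ := by
  rw [EuclideanSpace.norm_eq, EuclideanSpace.norm_eq]
  refine Real.sqrt_le_sqrt ?_
  rw [Fin.sum_univ_castSucc (f := fun i : Fin 3 => ‖y i‖ ^ 2)]
  simp only [planarProjE_apply]
  exact le_add_of_nonneg_right (sq_nonneg _)

/-- `planarProj` is `1`-Lipschitz (sup metric). [folklore] -/
theorem lipschitzWith_planarProj : LipschitzWith 1 (planarProj : 𝕋³ → 𝕋²) := by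
  refine LipschitzWith.of_dist_le_mul fun x y => ?_
  rw [NNReal.coe_one, one_mul]
  refine (dist_pi_le_iff dist_nonneg).2 fun i => ?_
  exact dist_le_pi_dist x y (Fin.castSucc i)

/-- The planar projection is continuous. [folklore] -/
theorem continuous_planarProj : Continuous (planarProj : 𝕋³ → 𝕋²) :=
  continuous_pi fun _ => continuous_apply _

/-- The planar projection is measurable. [folklore] -/
theorem measurable_planarProj : Measurable (planarProj : 𝕋³ → 𝕋²) :=
  continuous_planarProj.measurable

/-! ## Planar lifts of functions `T² → F` -/

section Lift

variable {F : Type*}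

/-- The periodic lift of a planar lift factors through the linear projection:
`lift (g ∘ π) = lift g ∘ πE`. [folklore] -/
theorem lift_comp_planarProj (g : 𝕋² → F) : lift (g ∘ planarProj) = lift g ∘ planarProjE := by
  funext y
  simp [planarProj_proj]

/-- The re-centred lifts of a planar lift: `liftAt (g ∘ π) x = liftAt g (π x) ∘ πE`. [folklore] -/
theorem liftAt_comp_planarProj (g : 𝕋² → F) (x : 𝕋³) :
    liftAt (g ∘ planarProj) x = liftAt g (planarProj x) ∘ planarProjE := by
  funext v
  simp [planarProj_add, planarProj_proj]

variable [NormedAddCommGroup F] [NormedSpace ℝ F]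

/-- Planar lifts of `Cⁿ` functions are `Cⁿ`. [folklore] -/
theorem IsContDiff.comp_planarProj {n : WithTop ℕ∞} {g : 𝕋² → F} (hg : IsContDiff n g) :
    IsContDiff n (g ∘ planarProj) := by
  change ContDiff ℝ n (lift (g ∘ planarProj))
  rw [lift_comp_planarProj]
  exact hg.comp planarProjE.contDiff

/-- Planar lifts of smooth functions are smooth. [folklore] -/
theorem IsSmooth.comp_planarProj {g : 𝕋² → F} (hg : IsSmooth g) : IsSmooth (g ∘ planarProj) :=
  IsContDiff.comp_planarProj hg

/-- Directional derivatives of planar lifts: `∂ᵥ(g ∘ π)(x) = ∂_{πv} g (π x)` (pure rewriting,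
no differentiability needed). [folklore] -/
theorem lineDeriv_comp_planarProj (g : 𝕋² → F) (x : 𝕋³) (v : E³) :
    lineDeriv (g ∘ planarProj) x v = lineDeriv g (planarProj x) (planarProjE v) := by
  unfold lineDeriv
  simp only [Function.comp_apply, planarProj_add, planarProj_proj, map_smul]

/-- Partial derivatives of planar lifts in the planar directions. [folklore] -/
theorem partialDeriv_comp_planarProj_castSucc (g : 𝕋² → F) (j : Fin 2) :
    partialDeriv (Fin.castSucc j) (g ∘ planarProj) = partialDeriv j g ∘ planarProj := by
  funext x
  rw [partialDeriv, lineDeriv_comp_planarProj, Function.comp_apply, partialDeriv]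
  congr 1
  ext i
  simp [planarProjE_apply, Fin.castSucc_inj]

/-- Planar lifts do not depend on the third coordinate. [folklore] -/
theorem partialDeriv_comp_planarProj_last (g : 𝕋² → F) :
    partialDeriv (Fin.last 2) (g ∘ planarProj) = 0 := by
  funext x
  rw [partialDeriv, lineDeriv_comp_planarProj]
  have h0 : planarProjE (EuclideanSpace.single (Fin.last 2) (1 : ℝ)) = 0 := by
    ext i
    have hi : Fin.castSucc i ≠ (2 : Fin 3) := fun h => by
      have h' := congrArg Fin.val h
      have := i.isLt
      simp only [Fin.val_castSucc] at h'
      simp at h'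
      omega
    simp [planarProjE_apply, hi]
  rw [h0]
  simp [lineDeriv]

/-- The Laplacian of a smooth planar lift is the planar lift of the Laplacian. [folklore] -/
theorem laplacian_comp_planarProj {g : 𝕋² → F} (hg : IsSmooth g) :
    laplacian (g ∘ planarProj) = laplacian g ∘ planarProj := by
  funext x
  rw [laplacian_eq_sum_partialDeriv_partialDeriv hg.comp_planarProj, Fin.sum_univ_castSucc,
    partialDeriv_comp_planarProj_last]
  simp only [partialDeriv_comp_planarProj_castSucc, Function.comp_apply,
    laplacian_eq_sum_partialDeriv_partialDeriv hg]
  have : partialDeriv (Fin.last 2) (0 : 𝕋³ → F) x = 0 := by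
    simp [partialDeriv, lineDeriv]
  rw [this, add_zero]

/-- The torus derivative of a `C¹` planar lift. [folklore] -/
theorem fderiv_comp_planarProj {g : 𝕋² → F} (hg : IsContDiff 1 g) (x : 𝕋³) :
    Torus.fderiv (g ∘ planarProj) x = (Torus.fderiv g (planarProj x)).comp planarProjE := by
  rw [Torus.fderiv, liftAt_comp_planarProj, Torus.fderiv]
  rw [_root_.fderiv_comp _ (by simpa using ((hg.liftAt _).differentiable one_ne_zero) 0)
    planarProjE.differentiableAt]
  simp

/-- Joint smoothness of time-dependent planar lifts. [folklore] -/
theorem IsSmoothSpaceTimeOn.comp_planarProj {S : Set ℝ} {g : ℝ → 𝕋² → F}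
    (hg : IsSmoothSpaceTimeOn S g) : IsSmoothSpaceTimeOn S (fun t => g t ∘ planarProj) := by
  have h : stLift (fun t => g t ∘ planarProj) = stLift g ∘ Prod.map id planarProjE := by
    funext p
    simp [stLift, planarProj_proj]
  unfold IsSmoothSpaceTimeOn
  rw [h]
  refine hg.comp (contDiff_id.prodMap planarProjE.contDiff).contDiffOn ?_
  rintro ⟨t, y⟩ ⟨ht, -⟩
  exact ⟨ht, mem_univ _⟩

/-- One-sided time derivatives commute with planar lifting (pointwise in `x`, by `rfl`). [folklore] -/
theorem timeDerivWithin_comp_planarProj (S : Set ℝ) (g : ℝ → 𝕋² → F) (t : ℝ) :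
    timeDerivWithin S (fun s => g s ∘ planarProj) t = timeDerivWithin S g t ∘ planarProj := by
  funext x
  rfl

end Lift

/-! ## The `2½`-dimensional embedding -/

/-- The `2½`-dimensional embedding `(a, r) ↦ (a₀, a₁, r)` of `ℝ² × ℝ` into `ℝ³`, a continuous
linear map. [folklore] -/
def planarEmbed : E² × ℝ →L[ℝ] E³ :=
  ((EuclideanSpace.equiv (Fin 3) ℝ).symm : (Fin 3 → ℝ) →L[ℝ] E³).comp
    (ContinuousLinearMap.pi fun i : Fin 3 =>
      Fin.lastCases (ContinuousLinearMap.snd ℝ E² ℝ)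
        (fun j : Fin 2 => (EuclideanSpace.proj j : E² →L[ℝ] ℝ).comp
          (ContinuousLinearMap.fst ℝ E² ℝ)) i)

/-- Evaluation lemma. [folklore] -/
theorem planarEmbed_apply (p : E² × ℝ) (i : Fin 3) :
    planarEmbed p i = Fin.lastCases p.2 (fun j : Fin 2 => p.1 j) i := by
  induction i using Fin.lastCases with
  | last => simp [planarEmbed, lastCases_two]
  | cast j => simp [planarEmbed, Fin.lastCases_castSucc]

/-- Evaluation lemma. [folklore] -/
@[simp]
theorem planarEmbed_apply_castSucc (p : E² × ℝ) (j : Fin 2) :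
    planarEmbed p (Fin.castSucc j) = p.1 j := by
  rw [planarEmbed_apply, Fin.lastCases_castSucc]

/-- Evaluation lemma. [folklore] -/
@[simp]
theorem planarEmbed_apply_two (p : E² × ℝ) : planarEmbed p 2 = p.2 := by
  rw [show (2 : Fin 3) = Fin.last 2 from rfl, planarEmbed_apply, Fin.lastCases_last]

/-- Evaluation lemma. [folklore] -/
@[simp]
theorem planarEmbed_apply_zero (p : E² × ℝ) : planarEmbed p 0 = p.1 0 :=
  planarEmbed_apply_castSucc p 0

/-- Evaluation lemma. [folklore] -/
@[simp]
theorem planarEmbed_apply_one (p : E² × ℝ) : planarEmbed p 1 = p.1 1 :=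
  planarEmbed_apply_castSucc p 1

/-- The linear projection retracts the embedding: `πE (a₀, a₁, r) = a`. [folklore] -/
theorem planarProjE_planarEmbed (p : E² × ℝ) : planarProjE (planarEmbed p) = p.1 := by
  ext j
  simp

/-- `‖(a, r)‖² = ‖a‖² + r²` for the embedded vector. [folklore] -/
theorem norm_sq_planarEmbed (p : E² × ℝ) : ‖planarEmbed p‖ ^ 2 = ‖p.1‖ ^ 2 + p.2 ^ 2 := by
  rw [EuclideanSpace.norm_sq_eq, EuclideanSpace.norm_sq_eq, Fin.sum_univ_castSucc]
  simp

/-- Inner products with embedded vectors split into the planar and the vertical parts. [folklore] -/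
theorem inner_planarEmbed_left (p : E² × ℝ) (w : E³) :
    ⟪planarEmbed p, w⟫_ℝ = ⟪p.1, planarProjE w⟫_ℝ + p.2 * w 2 := by
  simp only [EuclideanSpace.inner_eq_star_dotProduct, star_trivial, dotProduct,
    Fin.sum_univ_castSucc]
  simp [mul_comm]

/-- Inner products of embedded vectors: `⟪(a,r), (a',r')⟫ = ⟪a,a'⟫ + r r'`. [folklore] -/
theorem inner_planarEmbed (p q : E² × ℝ) :
    ⟪planarEmbed p, planarEmbed q⟫_ℝ = ⟪p.1, q.1⟫_ℝ + p.2 * q.2 := by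
  rw [inner_planarEmbed_left, planarProjE_planarEmbed, planarEmbed_apply_two]

/-- `‖(a, r)‖ ≤ ‖a‖ + |r|` for the embedded vector. [folklore] -/
theorem norm_planarEmbed_le (p : E² × ℝ) : ‖planarEmbed p‖ ≤ ‖p.1‖ + |p.2| := by
  have h1 : ‖planarEmbed p‖ ^ 2 ≤ (‖p.1‖ + |p.2|) ^ 2 := by
    rw [norm_sq_planarEmbed p, add_sq, ← sq_abs p.2]
    nlinarith [norm_nonneg p.1, abs_nonneg p.2]
  exact (pow_le_pow_iff_left₀ (norm_nonneg _) (add_nonneg (norm_nonneg _) (abs_nonneg _))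
    two_ne_zero).1 h1

/-! ## `2½`-dimensional fields on `T³` -/

/-- The `2½`-dimensional field `u(x) = (V(x₀,x₁), R(x₀,x₁))` on `T³` built from a planar vector
field `V` and a scalar `R` on `T²`. [folklore] -/
def twoHalf (V : 𝕋² → E²) (R : 𝕋² → ℝ) : 𝕋³ → E³ :=
  fun x => planarEmbed (V (planarProj x), R (planarProj x))

/-- A `2½`-dimensional field is the planar lift of the planar pairing. [folklore] -/
theorem twoHalf_eq_comp (V : 𝕋² → E²) (R : 𝕋² → ℝ) :
    twoHalf V R = (fun y => planarEmbed (V y, R y)) ∘ planarProj := rfl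

/-- Evaluation lemma. [folklore] -/
@[simp]
theorem twoHalf_apply_castSucc (V : 𝕋² → E²) (R : 𝕋² → ℝ) (x : 𝕋³) (j : Fin 2) :
    twoHalf V R x (Fin.castSucc j) = V (planarProj x) j := by
  simp [twoHalf]

/-- Evaluation lemma. [folklore] -/
@[simp]
theorem twoHalf_apply_two (V : 𝕋² → E²) (R : 𝕋² → ℝ) (x : 𝕋³) :
    twoHalf V R x 2 = R (planarProj x) := by
  simp [twoHalf]

/-- `twoHalf` is additive in `(V, R)`. [folklore] -/
theorem twoHalf_add (V V' : 𝕋² → E²) (R R' : 𝕋² → ℝ) :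
    twoHalf (V + V') (R + R') = twoHalf V R + twoHalf V' R' := by
  funext x
  simp only [twoHalf, Pi.add_apply, ← map_add, Prod.mk_add_mk]

/-- `twoHalf` is homogeneous in `(V, R)`. [folklore] -/
theorem twoHalf_smul (c : ℝ) (V : 𝕋² → E²) (R : 𝕋² → ℝ) :
    twoHalf (c • V) (c • R) = c • twoHalf V R := by
  funext x
  simp only [twoHalf, Pi.smul_apply, ← map_smul, Prod.smul_mk, smul_eq_mul]

/-- `twoHalf 0 0 = 0`. [folklore] -/
theorem twoHalf_zero : twoHalf (0 : 𝕋² → E²) (0 : 𝕋² → ℝ) = 0 := by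
  funext x
  exact map_zero planarEmbed

/-- `twoHalf` commutes with subtraction in `(V, R)`. [folklore] -/
theorem twoHalf_sub (V V' : 𝕋² → E²) (R R' : 𝕋² → ℝ) :
    twoHalf (V - V') (R - R') = twoHalf V R - twoHalf V' R' := by
  funext x
  simp only [twoHalf, Pi.sub_apply, ← map_sub, Prod.mk_sub_mk]

/-- Pointwise bound `‖(V,R)(x)‖ ≤ ‖V(πx)‖ + |R(πx)|`. [folklore] -/
theorem norm_twoHalf_le (V : 𝕋² → E²) (R : 𝕋² → ℝ) (x : 𝕋³) :
    ‖twoHalf V R x‖ ≤ ‖V (planarProj x)‖ + |R (planarProj x)| :=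
  norm_planarEmbed_le _

/-- Pointwise identity `‖(V,R)(x)‖² = ‖V(πx)‖² + R(πx)²`. [folklore] -/
theorem norm_sq_twoHalf (V : 𝕋² → E²) (R : 𝕋² → ℝ) (x : 𝕋³) :
    ‖twoHalf V R x‖ ^ 2 = ‖V (planarProj x)‖ ^ 2 + R (planarProj x) ^ 2 :=
  norm_sq_planarEmbed _

/-! ## Calculus of `2½`-dimensional fields -/

section Calculus

variable {V : 𝕋² → E²} {R : 𝕋² → ℝ}

/-- The planar pairing `y ↦ (V y, R y) ↦ (V₀, V₁, R)` as a function on `T²`. [folklore] -/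
theorem lift_planarEmbed_pair (V : 𝕋² → E²) (R : 𝕋² → ℝ) :
    lift (fun y => planarEmbed (V y, R y)) = fun a => planarEmbed (lift V a, lift R a) := rfl

/-- The planar pairing of `Cⁿ` data is `Cⁿ`. [folklore] -/
theorem IsContDiff.planarEmbed_pair {n : WithTop ℕ∞} (hV : IsContDiff n V) (hR : IsContDiff n R) :
    IsContDiff n (fun y => planarEmbed (V y, R y)) := by
  change ContDiff ℝ n (lift fun y => planarEmbed (V y, R y))
  rw [lift_planarEmbed_pair]
  exact planarEmbed.contDiff.comp (hV.prodMk hR)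

/-- Smoothness of `2½`-dimensional fields. [folklore] -/
theorem IsContDiff.twoHalf {n : WithTop ℕ∞} (hV : IsContDiff n V) (hR : IsContDiff n R) :
    IsContDiff n (twoHalf V R) := by
  rw [twoHalf_eq_comp]
  exact (hV.planarEmbed_pair hR).comp_planarProj

/-- `2½`-dimensional fields with smooth data are smooth. [folklore] -/
theorem IsSmooth.twoHalf (hV : IsSmooth V) (hR : IsSmooth R) : IsSmooth (twoHalf V R) :=
  IsContDiff.twoHalf hV hR

/-- The torus derivative of the planar pairing. [folklore] -/
theorem fderiv_planarEmbed_pair (hV : IsContDiff 1 V) (hR : IsContDiff 1 R) (y : 𝕋²) :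
    Torus.fderiv (fun y => planarEmbed (V y, R y)) y =
      planarEmbed.comp ((Torus.fderiv V y).prod (Torus.fderiv R y)) := by
  unfold Torus.fderiv
  have hV' : DifferentiableAt ℝ (liftAt V y) 0 := ((hV.liftAt y).differentiable one_ne_zero) 0
  have hR' : DifferentiableAt ℝ (liftAt R y) 0 := ((hR.liftAt y).differentiable one_ne_zero) 0
  have h := (planarEmbed.hasFDerivAt.comp (0 : E²)
    (hV'.hasFDerivAt.prodMk hR'.hasFDerivAt))
  exact h.fderiv

/-- Partial derivatives of the planar pairing. [folklore] -/
theorem partialDeriv_planarEmbed_pair (hV : IsContDiff 1 V) (hR : IsContDiff 1 R) (j : Fin 2) :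
    partialDeriv j (fun y => planarEmbed (V y, R y)) =
      fun y => planarEmbed (partialDeriv j V y, partialDeriv j R y) := by
  funext y
  rw [partialDeriv_eq_fderiv_apply (hV.planarEmbed_pair hR), fderiv_planarEmbed_pair hV hR,
    partialDeriv_eq_fderiv_apply hV, partialDeriv_eq_fderiv_apply hR]
  rfl

/-- Partial derivatives of `2½`-dimensional fields in the planar directions. [folklore] -/
theorem partialDeriv_twoHalf_castSucc (hV : IsContDiff 1 V) (hR : IsContDiff 1 R) (j : Fin 2) :
    partialDeriv (Fin.castSucc j) (twoHalf V R) = twoHalf (partialDeriv j V) (partialDeriv j R) := by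
  rw [twoHalf_eq_comp, partialDeriv_comp_planarProj_castSucc, partialDeriv_planarEmbed_pair hV hR]
  rfl

/-- `2½`-dimensional fields do not depend on the vertical coordinate. [folklore] -/
theorem partialDeriv_twoHalf_last (V : 𝕋² → E²) (R : 𝕋² → ℝ) :
    partialDeriv (Fin.last 2) (twoHalf V R) = 0 := by
  rw [twoHalf_eq_comp, partialDeriv_comp_planarProj_last]

/-- Components of `2½`-dimensional fields. [folklore] -/
theorem twoHalf_apply_castSucc_eq (V : 𝕋² → E²) (R : 𝕋² → ℝ) (j : Fin 2) :
    (fun x => twoHalf V R x (Fin.castSucc j)) = (fun y => V y j) ∘ planarProj := by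
  funext x; simp [twoHalf]

/-- Evaluation lemma. [folklore] -/
theorem twoHalf_apply_last_eq (V : 𝕋² → E²) (R : 𝕋² → ℝ) :
    (fun x => twoHalf V R x (Fin.last 2)) = R ∘ planarProj := by
  funext x
  rw [show (Fin.last 2 : Fin 3) = 2 from rfl]
  simp [twoHalf]

/-- **Divergence of `2½`-dimensional fields**: `div (V, R) = (div V) ∘ π` (no differentiability
needed: the vertical component does not depend on the vertical coordinate). [folklore] -/
theorem divergence_twoHalf (V : 𝕋² → E²) (R : 𝕋² → ℝ) :
    divergence (twoHalf V R) = divergence V ∘ planarProj := by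
  funext x
  rw [divergence, Fin.sum_univ_castSucc, twoHalf_apply_last_eq, partialDeriv_comp_planarProj_last,
    Pi.zero_apply, add_zero, Function.comp_apply, divergence]
  refine Finset.sum_congr rfl fun j _ => ?_
  rw [twoHalf_apply_castSucc_eq, partialDeriv_comp_planarProj_castSucc, Function.comp_apply]

/-- `2½`-dimensional fields with divergence-free planar part are divergence free. [folklore] -/
theorem IsDivFree.twoHalf (hV : IsDivFree V) (R : 𝕋² → ℝ) : IsDivFree (twoHalf V R) := by
  intro x
  rw [divergence_twoHalf, Function.comp_apply, hV]

/-- **The convective term of `2½`-dimensional fields**: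
`((V,R)·∇)(V,R) = ((V·∇)V, V·∇R) ∘ π` for `C¹` data. [folklore] -/
theorem convect_twoHalf (hV : IsContDiff 1 V) (hR : IsContDiff 1 R) :
    convect (twoHalf V R) (twoHalf V R) =
      twoHalf (convect V V) (fun y => ⟪V y, gradient R y⟫_ℝ) := by
  funext x
  rw [convect, twoHalf_eq_comp, fderiv_comp_planarProj (hV.planarEmbed_pair hR),
    ContinuousLinearMap.comp_apply, Function.comp_apply, planarProjE_planarEmbed,
    fderiv_planarEmbed_pair hV hR]
  simp only [twoHalf, ContinuousLinearMap.comp_apply, ContinuousLinearMap.prod_apply, convect]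
  rw [real_inner_comm, inner_gradient_left]

/-- **The Laplacian of `2½`-dimensional fields**: `Δ(V, R) = (ΔV, ΔR) ∘ π` for smooth data. [folklore] -/
theorem laplacian_twoHalf (hV : IsSmooth V) (hR : IsSmooth R) :
    laplacian (twoHalf V R) = twoHalf (laplacian V) (laplacian R) := by
  have hs : IsSmooth (fun y => planarEmbed (V y, R y)) := IsContDiff.planarEmbed_pair hV hR
  rw [twoHalf_eq_comp, laplacian_comp_planarProj hs]
  have h2 : laplacian (fun y => planarEmbed (V y, R y)) =
      fun y => planarEmbed (laplacian V y, laplacian R y) := by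
    funext y
    rw [laplacian_eq_sum_partialDeriv_partialDeriv hs, laplacian_eq_sum_partialDeriv_partialDeriv hV,
      laplacian_eq_sum_partialDeriv_partialDeriv hR]
    have h1 : ∀ j : Fin 2, partialDeriv j (partialDeriv j fun y => planarEmbed (V y, R y)) =
        fun y => planarEmbed (partialDeriv j (partialDeriv j V) y,
          partialDeriv j (partialDeriv j R) y) := by
      intro j
      rw [partialDeriv_planarEmbed_pair (hV.isContDiff (by simp)) (hR.isContDiff (by simp)),
        partialDeriv_planarEmbed_pair ((hV.partialDeriv j).isContDiff (by simp))
          ((hR.partialDeriv j).isContDiff (by simp))]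
    simp only [h1]
    rw [← map_sum]
    congr 1
  rw [h2]
  rfl

/-- Inner products of `2½`-dimensional fields: `⟪(V,R), (V',R')⟫ = (⟪V,V'⟫ + R R') ∘ π`. [folklore] -/
theorem inner_twoHalf (V V' : 𝕋² → E²) (R R' : 𝕋² → ℝ) (x : 𝕋³) :
    ⟪twoHalf V R x, twoHalf V' R' x⟫_ℝ =
      ⟪V (planarProj x), V' (planarProj x)⟫_ℝ + R (planarProj x) * R' (planarProj x) := by
  simp only [twoHalf, EuclideanSpace.inner_eq_star_dotProduct, star_trivial, dotProduct,
    Fin.sum_univ_castSucc, planarEmbed_apply_castSucc]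
  rw [show (Fin.last 2 : Fin 3) = 2 from rfl, planarEmbed_apply_two, planarEmbed_apply_two]
  ring

/-- Inner products of a `2½`-dimensional field with an arbitrary field on `T³`. [folklore] -/
theorem inner_twoHalf_left (V : 𝕋² → E²) (R : 𝕋² → ℝ) (w : E³) (x : 𝕋³) :
    ⟪twoHalf V R x, w⟫_ℝ = ⟪V (planarProj x), planarProjE w⟫_ℝ + R (planarProj x) * w 2 := by
  simp only [twoHalf, EuclideanSpace.inner_eq_star_dotProduct, star_trivial, dotProduct,
    Fin.sum_univ_castSucc, planarEmbed_apply_castSucc, planarProjE_apply]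
  rw [show (Fin.last 2 : Fin 3) = 2 from rfl, planarEmbed_apply_two]
  ring

end Calculus

/-! ## Time-dependent `2½`-dimensional fields -/

section SpaceTime

variable {S : Set ℝ} {V : ℝ → 𝕋² → E²} {R : ℝ → 𝕋² → ℝ}

/-- Joint smoothness of time-dependent `2½`-dimensional fields. [folklore] -/
theorem IsSmoothSpaceTimeOn.twoHalf (hV : IsSmoothSpaceTimeOn S V) (hR : IsSmoothSpaceTimeOn S R) :
    IsSmoothSpaceTimeOn S (fun t => twoHalf (V t) (R t)) := by
  have h : IsSmoothSpaceTimeOn S (fun t y => planarEmbed (V t y, R t y)) := by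
    have : stLift (fun t y => planarEmbed (V t y, R t y)) =
        planarEmbed ∘ fun p => (stLift V p, stLift R p) := by
      funext p; rfl
    unfold IsSmoothSpaceTimeOn
    rw [this]
    exact planarEmbed.contDiff.comp_contDiffOn (hV.prodMk hR)
  exact h.comp_planarProj

/-- **Time derivatives of `2½`-dimensional fields**: `∂ₜ(V, R) = (∂ₜV, ∂ₜR)` (one-sided, within
a time set of unique differentiability, at its points). [folklore] -/
theorem timeDerivWithin_twoHalf (hV : IsSmoothSpaceTimeOn S V) (hR : IsSmoothSpaceTimeOn S R)
    (hS : UniqueDiffOn ℝ S) {t : ℝ} (ht : t ∈ S) :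
    timeDerivWithin S (fun s => twoHalf (V s) (R s)) t =
      twoHalf (timeDerivWithin S V t) (timeDerivWithin S R t) := by
  funext x
  have h1 : HasDerivWithinAt (fun s => (V s (planarProj x), R s (planarProj x)))
      (timeDerivWithin S V t (planarProj x), timeDerivWithin S R t (planarProj x)) S t :=
    (hV.hasDerivWithinAt_slice ht (planarProj x)).prodMk
      (hR.hasDerivWithinAt_slice ht (planarProj x))
  have h2 := planarEmbed.hasFDerivAt.comp_hasDerivWithinAt t h1
  rw [timeDerivWithin]
  exact h2.derivWithin (hS t ht)

end SpaceTime

/-! ## Measure preservation and integrals of planar lifts -/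

/-- **The planar projection preserves volume**: `T³ = T¹ × T²` measurably and
measure-preservingly (`MeasurableEquiv.piFinSuccAbove` at the last coordinate), and the second
projection of a product of probability measures preserves the second factor. [folklore] -/
theorem measurePreserving_planarProj : MeasurePreserving (planarProj : 𝕋³ → 𝕋²) volume volume := by
  have h1 := measurePreserving_piFinSuccAbove (fun _ : Fin 3 => (volume : Measure UnitAddCircle))
    (Fin.last 2)
  have h2 : MeasurePreserving (Prod.snd : UnitAddCircle × (Fin 2 → UnitAddCircle) → _)
      ((volume : Measure UnitAddCircle).prod (Measure.pi fun _ : Fin 2 => volume))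
      (Measure.pi fun _ : Fin 2 => volume) := measurePreserving_snd
  have h3 := h2.comp h1
  have hfun : (Prod.snd ∘ (MeasurableEquiv.piFinSuccAbove (fun _ : Fin 3 => UnitAddCircle)
      (Fin.last 2))) = (planarProj : 𝕋³ → 𝕋²) := by
    funext x
    funext j
    change x ((Fin.last 2).succAbove j) = x (Fin.castSucc j)
    rw [Fin.succAbove_last]
  rw [hfun] at h3
  simpa [MeasureTheory.volume_pi] using h3

/-- Integrals of planar lifts: `∫_{T³} b(π x) dx = ∫_{T²} b`. [folklore] -/
theorem integral_comp_planarProj {E : Type*} [NormedAddCommGroup E] [NormedSpace ℝ E]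
    {b : 𝕋² → E} (hb : AEStronglyMeasurable b volume) :
    ∫ x, b (planarProj x) = ∫ y, b y := by
  have h := integral_map (μ := (volume : Measure 𝕋³)) (φ := planarProj) (f := b)
    measurePreserving_planarProj.measurable.aemeasurable
    (by rw [measurePreserving_planarProj.map_eq]; exact hb)
  rw [measurePreserving_planarProj.map_eq] at h
  exact h.symm

/-- Lower integrals of planar lifts: `∫⁻_{T³} b(π x) dx = ∫⁻_{T²} b`. [folklore] -/
theorem lintegral_comp_planarProj {b : 𝕋² → ℝ≥0∞} (hb : Measurable b) :
    ∫⁻ x, b (planarProj x) = ∫⁻ y, b y := by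
  rw [← measurePreserving_planarProj.lintegral_comp hb]

/-- Planar lifts are invariant under translations along the third axis. [folklore] -/
theorem comp_planarProj_add_single {β : Type*} (b : 𝕋² → β) (s : UnitAddCircle) (x : 𝕋³) :
    b (planarProj (x + Pi.single (Fin.last 2) s)) = b (planarProj x) := by
  congr 1
  funext j
  simp [castSucc_ne_two j]

/-- Characters with vanishing third frequency are planar lifts of planar characters. [folklore] -/
theorem mFourier_eq_comp_planarProj {K : Fin 3 → ℤ} (hK : K (Fin.last 2) = 0) (x : 𝕋³) :
    mFourier K x = mFourier (fun j : Fin 2 => K (Fin.castSucc j)) (planarProj x) := by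
  simp only [mFourier, ContinuousMap.coe_mk, Fin.prod_univ_castSucc, hK, fourier_zero, mul_one,
    planarProj_apply]

/-- **Fourier coefficients of planar lifts**: `𝓕(b ∘ π)(K) = 𝓕b(K₀, K₁)` if `K₂ = 0`, and `= 0`
otherwise. [folklore] -/
theorem mFourierCoeff_comp_planarProj {E : Type*} [NormedAddCommGroup E] [NormedSpace ℂ E]
    {b : 𝕋² → E} (hb : AEStronglyMeasurable b volume) (K : Fin 3 → ℤ) :
    mFourierCoeff (b ∘ planarProj) K =
      if K (Fin.last 2) = 0 then mFourierCoeff b (fun j : Fin 2 => K (Fin.castSucc j)) else 0 := by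
  split_ifs with hK
  · rw [mFourierCoeff_eq_integral_volume, mFourierCoeff_eq_integral_volume]
    have hK' : (-K) (Fin.last 2) = 0 := by rw [Pi.neg_apply, hK, neg_zero]
    simp_rw [mFourier_eq_comp_planarProj hK', Function.comp_apply]
    have : (fun x : 𝕋³ => mFourier (fun j : Fin 2 => (-K) (Fin.castSucc j)) (planarProj x) •
        b (planarProj x)) = (fun y : 𝕋² => mFourier (-fun j : Fin 2 => K (Fin.castSucc j)) y • b y) ∘
        planarProj := by
      funext x; rfl
    rw [show (∫ x : 𝕋³, mFourier (fun j : Fin 2 => (-K) (Fin.castSucc j)) (planarProj x) •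
        b (planarProj x)) = ∫ x : 𝕋³, ((fun y : 𝕋² => mFourier (-fun j : Fin 2 =>
          K (Fin.castSucc j)) y • b y) ∘ planarProj) x from rfl]
    exact integral_comp_planarProj ((mFourier _).continuous.aestronglyMeasurable.smul hb)
  · exact mFourierCoeff_eq_zero_of_forall_add_single
      (fun s x => comp_planarProj_add_single b s x) hK

end Literature.Analysis.FunctionSpaces.Torus

end
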